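import Summits.QuantumFields.YangMills.Theorems.BalabanUVNodesK2CornerRoadSign

/-!
# PORT-1 g2 (prover-ym-nodeO-port-1-g2-0): BY-NAME APPLICABILITY CHECK of the LANDED module `Theorems/BalabanUVNodesK2CornerRoadSign.lean` (THE SIGN CUTS; third file of the
# corner road after p599976 `…K2CornerRoad` and d1-w1's p607079 `…K2NamedJetsLimit`) — what a v7 LINE 2 in any of the four cuts {U3ᴷ, AnchorPositiveᴷ} (LINE 2″, p607079's
# concluder), {U3ᴷ, Anchorᴷ, Signᴷ} (sign twin, p599976's concluder), {U3ᴷ, AnchorAtPinᴷ κ⋆, LimPosAtPin κ⋆} (LINE 2‴, pinned sign) or {U3ᴷ, CornerSignᴷ} (LINE 2⁰, κ-FREE)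
# would conclude by ONE tree name.  SCRATCH ∕ EVIDENCE ONLY: the `stub_…` below are `sorry`ed HERE to exercise the concluders; `κstar` is an arbitrary placeholder pin
# (nobody has chosen a pin); nothing is registered or claimed by this file; K2⁷ OPEN; nothing of Bałaban asserted; YM mass gap (Clay) NOT proved.
-/

noncomputable section

/-! ## SCRATCH (not filed): BY-NAME APPLICABILITY CHECK of `Theorems/BalabanUVNodesK2CornerRoadSign.lean` (THE SIGN CUTS) against plan g82's v6 registered texts (5a75a2378c79b303
:241 `Window13`, :319 `RunRemAtSomeJets`, VERBATIM), idea-7 EDITION 4's texts (`CornerLimitSignSketch.lean` d6ef0d445ba59e3e: :1509 `U3TripleAtRecord13K`, :1518 `AnchorSomeJets13K`,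
:1524 `D1SignShadowingAnchor13K`, :1691 `limOfJs`, :1724 `Names`, :1799 `PositivelyNamable13K`, :1890 `AnchorPositiveJets13K`, VERBATIM), and the PINNED texts (CRIT-2 ROUND 4
re-deal (b) ∕ DEF-1 `K2V6Defs` v1.1 §4: skeleton-level `def κstar`, `stub_d1AtPin13 : ∀ F, ∃ A, OneLoopDrift (stepBal 2 F.L) A (beta0OfJs F (κstar F.L))`, `stub_runRemPinnedJets13`,
and this file's LINE 2‴ texts `AnchorAtPin13K` ∕ `LimPosAtPin13`; the κ-FREE LINE 2⁰ texts `CornerSign13K` ∕ `CornerLimPos13K`).  The `stub_…` below are `sorry`ed HERE ONLY to exercise the concluders; `κstar` is an ARBITRARY placeholder (no pin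
is chosen by anyone here); nothing is registered or claimed; K2⁷ OPEN; YM mass gap (Clay) NOT proved. -/
namespace Summit.QuantumFields.YangMills.Cruxes.EndpointGivenBR13SepCoPH.Port2CornerRoadSignApply

open Filter Topology
open Literature.MathematicalPhysics.QuantumFieldTheory.Balaban1983to89
open Literature.MathematicalPhysics.QuantumFieldTheory.Balaban1983to89.T4Continuum (T4Family)
open Literature.MathematicalPhysics.QuantumFieldTheory.Balaban1983to89.T4CouplingMatching (ScaleShiftRate HistLipschitz)
open Literature.MathematicalPhysics.QuantumFieldTheory.Balaban1983to89.Beta.Drift (OneLoopDrift)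
open Literature.MathematicalPhysics.QuantumFieldTheory.Balaban1983to89.Beta.RateCertificate (CauchyRate)
open Summit.QuantumFields.YangMills.Theorems.BalabanUVNodesK2JsOfRecord (StepColourData beta0OfJs)
open Summit.QuantumFields.YangMills.Theorems.BalabanUVNodesK2NamedJetsRemAt (ScaleAnchor)
open Summit.QuantumFields.YangMills.Theorems.BalabanUVNodesK2NamedJetsRunRemAt (RunRemAt)
open Summit.QuantumFields.YangMills.Theorems.BalabanUVNodesK2CornerRoadSign

/-- v6 :241 verbatim -/
def Window13 (F : T4Family) (θ : Node00.Stage13HParams F 2) (hP : θ.Provisos₁₃SepCoPH F 2) : Prop :=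
  ∃ γ₁ : ℝ, 0 < γ₁ ∧ ∀ γ : ℝ, 0 < γ → γ ≤ γ₁ → ∃ P : B12.RunParams, 1 ≤ P.K ∧ ((Node00.datumOfRecord₁₃SepCoPH F 2 θ hP).C P).flow.InInterval γ P.K

/-- v6 :319 verbatim -/
def RunRemAtSomeJets : Prop :=
  ∀ (F : T4Family) (θ : Node00.Stage13HParams F 2) (hP : θ.Provisos₁₃SepCoPH F 2), (θ.ZhUnity F 2 ∧ θ.SlotsNondegenerate₁₃ F 2) → θ.Admissible F 2 →
    B16.EndStatementBPrinted (Node00.datumOfRecord₁₃SepCoPH F 2 θ hP).C → Window13 F θ hP →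
    ∃ κ : StepColourData, RunRemAt F κ θ hP θ.cβ

/-- sketch :1509 verbatim -/
def U3TripleAtRecord13K : Prop :=
  ∀ (F : T4Family) (θ : Node00.Stage13HParams F 2) (hP : θ.Provisos₁₃SepCoPH F 2), (θ.ZhUnity F 2 ∧ θ.SlotsNondegenerate₁₃ F 2) → θ.Admissible F 2 →
    B16.EndStatementBPrinted (Node00.datumOfRecord₁₃SepCoPH F 2 θ hP).C → Window13 F θ hP →
      ∃ (c C ρ : ℝ) (Λ : ℕ → ℕ → ℝ), 0 ≤ c ∧ 0 < ρ ∧ ρ < 1 ∧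
        ScaleShiftRate c ρ θ.γ (Node00.datumOfRecord₁₃SepCoPH F 2 θ hP).βfun ∧
          HistLipschitz Λ θ.γ (Node00.datumOfRecord₁₃SepCoPH F 2 θ hP).βfun ∧ T4CouplingMatching.FadingMemory C ρ Λ

/-- sketch :1518 verbatim -/
def AnchorSomeJets13K : Prop :=
  ∀ (F : T4Family) (θ : Node00.Stage13HParams F 2) (hP : θ.Provisos₁₃SepCoPH F 2), (θ.ZhUnity F 2 ∧ θ.SlotsNondegenerate₁₃ F 2) → θ.Admissible F 2 →
    B16.EndStatementBPrinted (Node00.datumOfRecord₁₃SepCoPH F 2 θ hP).C → Window13 F θ hP →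
      ∃ κ : StepColourData, ScaleAnchor (Node00.datumOfRecord₁₃SepCoPH F 2 θ hP).βfun (fun k => θ.cβ * beta0OfJs F κ k)

/-- sketch :1524 verbatim -/
def D1SignShadowingAnchor13K : Prop :=
  ∀ (F : T4Family) (κ : StepColourData) (θ : Node00.Stage13HParams F 2) (hP : θ.Provisos₁₃SepCoPH F 2), (θ.ZhUnity F 2 ∧ θ.SlotsNondegenerate₁₃ F 2) → θ.Admissible F 2 →
    B16.EndStatementBPrinted (Node00.datumOfRecord₁₃SepCoPH F 2 θ hP).C → Window13 F θ hP →
      ScaleAnchor (Node00.datumOfRecord₁₃SepCoPH F 2 θ hP).βfun (fun k => θ.cβ * beta0OfJs F κ k) →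
        ∃ e : ℝ, 0 < e ∧ ∃ k₀ : ℕ, ∀ k, k₀ ≤ k → e ≤ beta0OfJs F κ k

/-- sketch :1691 verbatim -/
def limOfJs (F : T4Family) (κ : StepColourData) : ℝ := CauchyRate.lim (beta0OfJs F κ)

/-- sketch :1724 verbatim -/
def Names (F : T4Family) (κ : StepColourData) (θ : Node00.Stage13HParams F 2) (hP : θ.Provisos₁₃SepCoPH F 2) : Prop :=
  ScaleAnchor (Node00.datumOfRecord₁₃SepCoPH F 2 θ hP).βfun (fun k => θ.cβ * beta0OfJs F κ k)

/-- sketch :1799 verbatim -/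
def PositivelyNamable13K : Prop :=
  ∀ (F : T4Family) (κ : StepColourData) (θ : Node00.Stage13HParams F 2) (hP : θ.Provisos₁₃SepCoPH F 2), (θ.ZhUnity F 2 ∧ θ.SlotsNondegenerate₁₃ F 2) → θ.Admissible F 2 →
    B16.EndStatementBPrinted (Node00.datumOfRecord₁₃SepCoPH F 2 θ hP).C → Window13 F θ hP →
      Names F κ θ hP → 0 < limOfJs F κ

/-- sketch :1890 verbatim -/
def AnchorPositiveJets13K : Prop :=
  ∀ (F : T4Family) (θ : Node00.Stage13HParams F 2) (hP : θ.Provisos₁₃SepCoPH F 2), (θ.ZhUnity F 2 ∧ θ.SlotsNondegenerate₁₃ F 2) → θ.Admissible F 2 →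
    B16.EndStatementBPrinted (Node00.datumOfRecord₁₃SepCoPH F 2 θ hP).C → Window13 F θ hP →
      ∃ κ : StepColourData, 0 < limOfJs F κ ∧ Names F κ θ hP

/-- PLACEHOLDER PIN (arbitrary; a pinned v7 would carry a skeleton-level `def κ⋆` whose VALUE is the β sub-cell's (P6) word — NOT chosen here). -/
def κstar : ℕ → StepColourData := fun _ => ⟨0, 0, 0, 0, fun _ _ _ _ => 0⟩

/-- LINE 2‴ text: the pinned member NAMES every prefixed admissible record (def-T; XL). -/
def AnchorAtPin13K : Prop :=
  ∀ (F : T4Family) (θ : Node00.Stage13HParams F 2) (hP : θ.Provisos₁₃SepCoPH F 2), (θ.ZhUnity F 2 ∧ θ.SlotsNondegenerate₁₃ F 2) → θ.Admissible F 2 →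
    B16.EndStatementBPrinted (Node00.datumOfRecord₁₃SepCoPH F 2 θ hP).C → Window13 F θ hP → Names F (κstar F.L) θ hP

/-- LINE 2‴ text: ONE SIGN PER FAMILY at the pin (θ-free). -/
def LimPosAtPin13 : Prop := ∀ F : T4Family, 0 < limOfJs F (κstar F.L)

/-- CRIT-2 ROUND 4 re-deal (b) ∕ `K2V6Defs` §4 `hD1` text at the placeholder pin. -/
def D1AtPin13 : Prop := ∀ F : T4Family, ∃ A : ℝ, OneLoopDrift (B12Normalization.stepBal 2 F.L) A (beta0OfJs F (κstar F.L))

/-- CRIT-2 ROUND 4 re-deal (b) ∕ `K2V6Defs` §4 `hRun` text at the placeholder pin. -/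
def RunRemPinnedJets13 : Prop :=
  ∀ (F : T4Family) (θ : Node00.Stage13HParams F 2) (hP : θ.Provisos₁₃SepCoPH F 2), (θ.ZhUnity F 2 ∧ θ.SlotsNondegenerate₁₃ F 2) → θ.Admissible F 2 →
    B16.EndStatementBPrinted (Node00.datumOfRecord₁₃SepCoPH F 2 θ hP).C → Window13 F θ hP → RunRemAt F (κstar F.L) θ hP θ.cβ

/-- would-be stubs, sorried HERE ONLY (scratch) -/
theorem stub_u3Triple13K : U3TripleAtRecord13K := by sorry
/-- scratch -/
theorem stub_anchorPositiveJets13K : AnchorPositiveJets13K := by sorry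
/-- scratch -/
theorem stub_anchorSomeJets13K : AnchorSomeJets13K := by sorry
/-- scratch -/
theorem stub_d1Sign13K : D1SignShadowingAnchor13K := by sorry
/-- scratch -/
theorem stub_anchorAtPin13K : AnchorAtPin13K := by sorry
/-- scratch -/
theorem stub_limPosAtPin13 : LimPosAtPin13 := by sorry
/-- scratch -/
theorem stub_d1AtPin13 : D1AtPin13 := by sorry
/-- scratch -/
theorem stub_runRemPinnedJets13 : RunRemPinnedJets13 := by sorry

/-- BY NAME — LINE 2‴ (pinned sign edition): the crux decl from three stubs by ONE tree name. -/
example : Summit.QuantumFields.YangMills.Theses.BalabanUVNodes.EndpointGivenBR13SepCoPH :=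
  EndpointGivenBR13SepCoPH_of_u3K_anchorAtPin_limPosAtPin κstar stub_u3Triple13K stub_anchorAtPin13K stub_limPosAtPin13

/-- BY NAME — re-deal (b)'s pinned run text + the pinned SIGN + U3ᴷ. -/
example : Summit.QuantumFields.YangMills.Theses.BalabanUVNodes.EndpointGivenBR13SepCoPH :=
  EndpointGivenBR13SepCoPH_of_u3K_runRemAtPin_limPosAtPin κstar stub_u3Triple13K stub_runRemPinnedJets13 stub_limPosAtPin13

/-- BY NAME — re-deal (b)'s pinned (D1) VALUE text ⟹ the pinned SIGN text. -/
example : LimPosAtPin13 := limPosAtPin_of_pinnedDrift κstar stub_d1AtPin13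

/-- BY NAME — the pinned run text ⟹ the pinned naming text. -/
example : AnchorAtPin13K := anchorAtPin_of_runRemAtPin κstar stub_runRemPinnedJets13

/-- BY NAME — pinned naming + pinned sign ⟹ idea-7's `AnchorPositiveJets13K`; pinned naming + U3ᴷ ⟹ v6's registered 2ᴮ″ text. -/
example : AnchorPositiveJets13K := anchorPositiveK_of_anchorAtPin_limPosAtPin κstar stub_anchorAtPin13K stub_limPosAtPin13
/-- BY NAME -/
example : RunRemAtSomeJets := runRemAtSomeJets_of_u3K_anchorAtPin κstar stub_u3Triple13K stub_anchorAtPin13K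

/-- BY NAME — LINE 2″'s stub ⟺ the sign twin's pair; under LINE 2″ v6's registered 2ᴮ″. -/
example : AnchorPositiveJets13K ↔ (AnchorSomeJets13K ∧ D1SignShadowingAnchor13K) := anchorPositiveK_iff_anchorK_and_signK
/-- BY NAME -/
example : AnchorPositiveJets13K := anchorPositiveK_of_anchorK_signK stub_anchorSomeJets13K stub_d1Sign13K
/-- BY NAME -/
example : RunRemAtSomeJets := runRemAtSomeJets_of_u3K_anchorPositiveK stub_u3Triple13K stub_anchorPositiveJets13K

/-- BY NAME — 9.2e: `D1SignShadowingAnchor13K ⟺ PositivelyNamable13K`. -/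
example : D1SignShadowingAnchor13K ↔ PositivelyNamable13K := signK_iff_limPosAtAnchoringK

/-- BY NAME — the pinned sign text in floor form. -/
example : LimPosAtPin13 ↔ ∀ F : T4Family, ∃ e : ℝ, 0 < e ∧ ∃ k₀ : ℕ, ∀ k, k₀ ≤ k → e ≤ beta0OfJs F (κstar F.L) k := limPosAtPin_iff_eventuallyPosAtPin κstar

/-- LINE 2⁰ text (κ-FREE, floor form): the asymptotic-freedom SIGN of the corner values of the β of record — ONE BIT about def-T's β. -/
def CornerSign13K : Prop :=
  ∀ (F : T4Family) (θ : Node00.Stage13HParams F 2) (hP : θ.Provisos₁₃SepCoPH F 2), (θ.ZhUnity F 2 ∧ θ.SlotsNondegenerate₁₃ F 2) → θ.Admissible F 2 →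
    B16.EndStatementBPrinted (Node00.datumOfRecord₁₃SepCoPH F 2 θ hP).C → Window13 F θ hP →
      ∀ b : ℕ → ℝ, ScaleAnchor (Node00.datumOfRecord₁₃SepCoPH F 2 θ hP).βfun b → ∃ e : ℝ, 0 < e ∧ ∃ k₀ : ℕ, ∀ k, k₀ ≤ k → e ≤ b k

/-- LINE 2⁰ text (κ-FREE, limit form = idea-7 ed.1's `CornerSignRecord13` re-based on DEF-1's `ScaleAnchor`, p607079's conjunct without its ∃κ guard). -/
def CornerLimPos13K : Prop :=
  ∀ (F : T4Family) (θ : Node00.Stage13HParams F 2) (hP : θ.Provisos₁₃SepCoPH F 2), (θ.ZhUnity F 2 ∧ θ.SlotsNondegenerate₁₃ F 2) → θ.Admissible F 2 →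
    B16.EndStatementBPrinted (Node00.datumOfRecord₁₃SepCoPH F 2 θ hP).C → Window13 F θ hP →
      ∀ b : ℕ → ℝ, ScaleAnchor (Node00.datumOfRecord₁₃SepCoPH F 2 θ hP).βfun b → ∀ binf : ℝ, Tendsto b atTop (𝓝 binf) → 0 < binf

/-- scratch -/
theorem stub_cornerSign13K : CornerSign13K := by sorry
/-- scratch -/
theorem stub_cornerLimPos13K : CornerLimPos13K := by sorry

/-- BY NAME — LINE 2⁰ (κ-FREE): the crux decl from K3⁷'s letters + ONE sign bit, by ONE tree name. -/
example : Summit.QuantumFields.YangMills.Theses.BalabanUVNodes.EndpointGivenBR13SepCoPH :=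
  EndpointGivenBR13SepCoPH_of_u3K_cornerSignK stub_u3Triple13K stub_cornerSign13K
/-- BY NAME — limit form. -/
example : Summit.QuantumFields.YangMills.Theses.BalabanUVNodes.EndpointGivenBR13SepCoPH :=
  EndpointGivenBR13SepCoPH_of_u3K_cornerLimPosK stub_u3Triple13K stub_cornerLimPos13K
/-- BY NAME — LINE 2″'s stub factors: `AnchorPositiveJets13K → CornerSign13K`, and `AnchorSomeJets13K → CornerSign13K → AnchorPositiveJets13K`. -/
example : CornerSign13K := cornerSignK_of_anchorPositiveK stub_anchorPositiveJets13K
/-- BY NAME -/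
example : AnchorPositiveJets13K := anchorPositiveK_of_anchorK_cornerSignK stub_anchorSomeJets13K stub_cornerSign13K

/-- LINE 2⁰ ∃-form text (κ-free twin of `AnchorPositiveJets13K`). -/
def SomeCornerPos13K : Prop :=
  ∀ (F : T4Family) (θ : Node00.Stage13HParams F 2) (hP : θ.Provisos₁₃SepCoPH F 2), (θ.ZhUnity F 2 ∧ θ.SlotsNondegenerate₁₃ F 2) → θ.Admissible F 2 →
    B16.EndStatementBPrinted (Node00.datumOfRecord₁₃SepCoPH F 2 θ hP).C → Window13 F θ hP →
      ∃ b : ℕ → ℝ, ScaleAnchor (Node00.datumOfRecord₁₃SepCoPH F 2 θ hP).βfun b ∧ ∃ e : ℝ, 0 < e ∧ ∃ k₀ : ℕ, ∀ k, k₀ ≤ k → e ≤ b k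
/-- scratch -/
theorem stub_someCornerPos13K : SomeCornerPos13K := by sorry
/-- BY NAME — LINE 2⁰ ∃-form. -/
example : Summit.QuantumFields.YangMills.Theses.BalabanUVNodes.EndpointGivenBR13SepCoPH :=
  EndpointGivenBR13SepCoPH_of_u3K_someCornerPosK stub_u3Triple13K stub_someCornerPos13K

end Summit.QuantumFields.YangMills.Cruxes.EndpointGivenBR13SepCoPH.Port2CornerRoadSignApply

end
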